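import Summits.ResolutionOfSingularities.ResolutionOfSingularities.Theorems.EquisingularLiftEquisingularLiftNatPhaseBFinish
import Mathlib.RingTheory.RegularLocalRing.Polynomial
import HarnessLib

/-!
# [OURS · L1 W4.5(b) · EL♮(3)] ORDINARY-NOSE CHARTS I — the TRANSVERSAL A₁ model `{xy = 0}`: the chart `ȳ` of its blow-up along the
# double line `(x̄, ȳ)` is the sheet `{x = 0}`, an affine plane (THEOREM A (2.7); crux `EquisingularLiftNatThree` =
# stmt-ResolutionOfSingularities-20148; node 15660).  Part II (the PINCH model) = `…NatOrdinaryNosePinchChart`.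

HONEST FRAMING. OURS (cell res-hironaka, crux chain w45b, slot W4.5(b)); NOT a statement of any manuscript; replaces the role of NOTHING
in the manuscript; AI-written, AI review is weaker than expert review; nothing of EL♮(3) is proved here. Helper
`--supports stmt-ResolutionOfSingularities-20148 --as helper`. Kernel twin of memo `L/res-L1-w45b-lead-1/EQUISINGULAR-NOSES.md`
(lead-1 g21, v1.1 c83fb69449b80442) §2, step (2.7): after the `t` sections at the triple points, THEOREM A's last move is ONE round
along the lifted double curve; downstairs it is the blow-up of the running 3-fold along the REDUCED double curve `Z^st`, and the strict
transform of an ordinary surface is regular because its two local models along `Z` resolve in one step: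

* the TRANSVERSAL A₁ model `𝒴₁ = Spec k[x,y,t]/(xy)` (two sheets crossing along `Z = V(x,y)`), chart `ȳ` of `Bl_{(x̄,ȳ)} 𝒴₁`:
  `B₁ = 𝒪_{𝒴₁}[(x̄,ȳ)/ȳ] ⊆ 𝒪_{𝒴₁}[1/ȳ]` — here `x̄ = 0` in `𝒪_{𝒴₁}[1/ȳ]` (`x̄·ȳ = 0`), so the fraction `x̄/ȳ` vanishes and
  **`ψ₁ : k[y,t] → B₁` is a bijection** (`A1Chart.ψ_bijective`): the chart is the sheet `{x = 0}`, an affine plane — regular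
  (`A1Chart.isRegularRing_B`); the chart `x̄` is the other sheet by symmetry;
* the PINCH (Whitney umbrella) model `𝒴₂ = Spec k[x,y,z]/(x² − zy²)`, chart `x̄` of `Bl_{(x̄,ȳ)} 𝒴₂`:
  `B₂ = 𝒪_{𝒴₂}[(x̄,ȳ)/x̄] ⊆ 𝒪_{𝒴₂}[1/x̄]` — with `s := ȳ/x̄` one has `z̄·s² = 1` (`x² = zy²` divided by `x²`), so `s` is a unit and
  **`ψ₂ : k[x,s][1/s] → B₂` is a bijection** (`PinchChart.ψ_bijective`), `z̄ = s⁻²`, `ȳ = x̄s`: the chart is the localised plane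
  `Spec k[x, s, s⁻¹]` — regular (`PinchChart.isRegularRing_B`, via `isRegularRing_localization`). The pinch chart `ȳ`
  (`k[x₁,y,z]/(x₁² − z) ≅ k[x₁,y]`) is, up to the renaming `(x, y, z) ↦ (y₃, y₁, −u)`, ✓ `PhaseBFinish.isRegularRing_B` (p565612) and
  is cited, not re-proved.

So on every chart the strict transform of an ordinary nose under the round along its reduced double curve is regular — the
computational content of THEOREM A (2.7) (the rest of Theorem A — flatness of `π_*𝒪_𝒮/𝒪_𝓗`, the conductor square, henselian
sheets — is by hand).  Proof pattern = the template ✓ `PhaseBFinish` (surjectivity from the graph relations and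
`blowupAlgebra.eval_surjective`; injectivity from an explicit left inverse after localisation).
Coordinates: A₁ model `X 0, X 1, X 2 = x, y, t`, model plane `X 0, X 1 = y, t`; pinch model `X 0, X 1, X 2 = x, y, z`, model
`X 0, X 1 = x, s` localised at `s`.

References: memo EQUISINGULAR-NOSES.md §2 (2.7); [StacksProject, Tags 052P/080E]; [GortzWedhorn2020, (13.19)].
-/

set_option linter.dupNamespace false -- mandated namespace `Summit.<Summit>.<Problem>` of this single-conjunct summit

noncomputable section

universe u

open Literature.AlgebraicGeometry.Resolution MvPolynomial

namespace Summit.ResolutionOfSingularities.ResolutionOfSingularities.Cruxes.EquisingularLiftNat.Sections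

/-! ## Part I — the transversal A₁ model `{xy = 0}`, chart `ȳ` -/

namespace A1Chart

variable (k : Type u) [CommRing k]

/-- The equation `xy` of the A₁ model (coordinates `X 0, X 1, X 2 = x, y, t`). OURS bookkeeping. -/
def rel : MvPolynomial (Fin 3) k := X 0 * X 1

/-- `𝒪_{𝒴₁} = k[x,y,t]/(xy)`. OURS bookkeeping. -/
abbrev OY : Type u := MvPolynomial (Fin 3) k ⧸ Ideal.span {rel k}

/-- `k[x,y,t] → 𝒪_{𝒴₁}`. OURS bookkeeping. -/
abbrev mkY : MvPolynomial (Fin 3) k →+* OY k := Ideal.Quotient.mk (Ideal.span {rel k})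

/-- The trace `(ȳ, x̄)` of the round, chart element first. OURS bookkeeping. -/
def tr : Fin 2 → OY k := ![mkY k (X 1), mkY k (X 0)]

/-- The chart `B₁ = 𝒪_{𝒴₁}[(x̄,ȳ)/ȳ] ⊆ 𝒪_{𝒴₁}[1/ȳ]`. OURS bookkeeping. -/
abbrev B : Subalgebra (OY k) (Localization.Away (tr k 0)) := blowupAlgebra (Ideal.span (Set.range (tr k))) (tr k 0)

/-- The values of the model coordinates `y, t` in `B₁`: `ȳ`, `t̄`. OURS bookkeeping. -/
def cv : Fin 2 → B k := ![algebraMap (OY k) (B k) (mkY k (X 1)), algebraMap (OY k) (B k) (mkY k (X 2))]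

/-- **`ψ₁ : k[y, t] → B₁`**. OURS bookkeeping. -/
def ψ : MvPolynomial (Fin 2) k →+* B k :=
  MvPolynomial.eval₂Hom ((algebraMap (OY k) (B k)).comp ((mkY k).comp MvPolynomial.C)) (cv k)

/-- The model equation in `𝒪_{𝒴₁}`: `ȳ · x̄ = 0`. [folklore] -/
theorem y_mul_x : tr k 0 * mkY k (X 0) = 0 := by
  change mkY k (X 1) * mkY k (X 0) = 0
  rw [← map_mul, Ideal.Quotient.eq_zero_iff_mem]
  have h : (X 1 * X 0 : MvPolynomial (Fin 3) k) = rel k := by rw [rel]; ring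
  rw [h]
  exact Ideal.subset_span rfl

/-- **`x̄ = 0` in `𝒪_{𝒴₁}[1/ȳ]`** — on the chart `ȳ ≠ 0` only the sheet `{x = 0}` survives. [folklore] -/
theorem algebraMap_x_eq_zero : algebraMap (OY k) (Localization.Away (tr k 0)) (mkY k (X 0)) = 0 := by
  rw [IsLocalization.map_eq_zero_iff (Submonoid.powers (tr k 0))]
  exact ⟨⟨tr k 0, Submonoid.mem_powers _⟩, y_mul_x k⟩

/-- `ȳ · (1/ȳ) = 1` in `𝒪_{𝒴₁}[1/ȳ]`. [folklore] -/
theorem y_mul_invSelf :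
    algebraMap (OY k) (Localization.Away (tr k 0)) (tr k 0) * IsLocalization.Away.invSelf (tr k 0) = 1 :=
  IsLocalization.Away.mul_invSelf (S := Localization.Away (tr k 0)) (tr k 0)

/-- `ψ₁` on constants. [folklore] -/
theorem ψ_C (a : k) : ψ k (C a) = algebraMap (OY k) (B k) (mkY k (C a)) := MvPolynomial.eval₂Hom_C _ _ a

/-- `ψ₁ y = ȳ`. [folklore] -/
theorem ψ_X₀ : ψ k (X 0) = algebraMap (OY k) (B k) (mkY k (X 1)) := MvPolynomial.eval₂Hom_X' _ _ 0

/-- `ψ₁ t = t̄`. [folklore] -/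
theorem ψ_X₁ : ψ k (X 1) = algebraMap (OY k) (B k) (mkY k (X 2)) := MvPolynomial.eval₂Hom_X' _ _ 1

/-- `x̄ = 0` in `B₁`. [folklore] -/
theorem algebraMap_x_eq_zero_B : algebraMap (OY k) (B k) (mkY k (X 0)) = 0 := by
  apply Subtype.ext
  exact algebraMap_x_eq_zero k

/-- The fraction `x̄/ȳ` vanishes in `B₁`. [folklore] -/
theorem frac_one_eq_zero : blowupAlgebra.frac (tr k) 0 1 = 0 := by
  apply Subtype.ext
  rw [blowupAlgebra.coe_frac, ZeroMemClass.coe_zero]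
  change algebraMap (OY k) (Localization.Away (tr k 0)) (mkY k (X 0)) * _ = 0
  rw [algebraMap_x_eq_zero, zero_mul]

/-- Every `x̄ⱼ` lies in the image of `ψ₁`. [folklore] -/
theorem algebraMap_X_mem_range (j : Fin 3) : algebraMap (OY k) (B k) (mkY k (X j)) ∈ (ψ k).range := by
  match j with
  | ⟨0, _⟩ => exact ⟨0, by rw [map_zero]; exact (algebraMap_x_eq_zero_B k).symm⟩
  | ⟨1, _⟩ => exact ⟨X 0, ψ_X₀ k⟩
  | ⟨2, _⟩ => exact ⟨X 1, ψ_X₁ k⟩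

/-- Every constant lies in the image of `ψ₁`. [folklore] -/
theorem algebraMap_mem_range (y : OY k) : algebraMap (OY k) (B k) y ∈ (ψ k).range := by
  obtain ⟨G, rfl⟩ := Ideal.Quotient.mk_surjective y
  induction G using MvPolynomial.induction_on with
  | C a => exact ⟨C a, ψ_C k a⟩
  | add p q hp hq => rw [map_add, map_add]; exact add_mem hp hq
  | mul_X p j hp => rw [map_mul, map_mul]; exact mul_mem hp (algebraMap_X_mem_range k j)

/-- Every fraction lies in the image of `ψ₁`. [folklore] -/
theorem frac_mem_range (j : Fin 2) : blowupAlgebra.frac (tr k) 0 j ∈ (ψ k).range := by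
  match j with
  | ⟨0, _⟩ =>
    refine ⟨1, ?_⟩
    rw [map_one]
    apply Subtype.ext
    rw [blowupAlgebra.coe_frac, OneMemClass.coe_one]
    exact (y_mul_invSelf k).symm
  | ⟨1, _⟩ => exact ⟨0, by rw [map_zero]; exact (frac_one_eq_zero k).symm⟩

/-- **`ψ₁` is onto.** [folklore] -/
theorem ψ_surjective : Function.Surjective (ψ k) := by
  intro z
  obtain ⟨F, rfl⟩ := blowupAlgebra.eval_surjective (tr k) 0 z
  suffices h : (blowupAlgebra.eval (tr k) 0 F) ∈ (ψ k).range by exact h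
  induction F using MvPolynomial.induction_on with
  | C y => rw [blowupAlgebra.eval_C]; exact algebraMap_mem_range k y
  | add p q hp hq => rw [map_add]; exact add_mem hp hq
  | mul_X p j hp => rw [map_mul, blowupAlgebra.eval_X]; exact mul_mem hp (frac_mem_range k j.1)

/-- The inverse substitution `x ↦ 0, y ↦ y, t ↦ t`. OURS bookkeeping. -/
def lamVal : Fin 3 → MvPolynomial (Fin 2) k := ![0, X 0, X 1]

/-- `λ(x) = 0`. OURS bookkeeping. -/
theorem lamVal_0 : lamVal k 0 = 0 := rfl

/-- `λ(y) = y`. OURS bookkeeping. -/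
theorem lamVal_1 : lamVal k 1 = X 0 := rfl

/-- `λ(t) = t`. OURS bookkeeping. -/
theorem lamVal_2 : lamVal k 2 = X 1 := rfl

/-- The substitution kills `xy`. [folklore] -/
theorem span_rel_le_ker : Ideal.span {rel k} ≤ RingHom.ker (MvPolynomial.eval₂Hom MvPolynomial.C (lamVal k)) := by
  rw [Ideal.span_le, Set.singleton_subset_iff, SetLike.mem_coe, RingHom.mem_ker, rel]
  simp only [map_mul, MvPolynomial.eval₂Hom_X', lamVal_0, lamVal_1]
  ring

/-- `λ : 𝒪_{𝒴₁} → k[y,t][1/y]`. OURS bookkeeping. -/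
def lam : OY k →+* Localization.Away (X 0 : MvPolynomial (Fin 2) k) :=
  Ideal.Quotient.lift (Ideal.span {rel k})
    ((algebraMap (MvPolynomial (Fin 2) k) (Localization.Away (X 0 : MvPolynomial (Fin 2) k))).comp
      (MvPolynomial.eval₂Hom MvPolynomial.C (lamVal k)))
    (fun a ha => by rw [RingHom.comp_apply, RingHom.mem_ker.mp (span_rel_le_ker k ha), map_zero])

/-- `λ` on classes. [folklore] -/
theorem lam_mkY (F : MvPolynomial (Fin 3) k) :
    lam k (mkY k F) = algebraMap (MvPolynomial (Fin 2) k) (Localization.Away (X 0 : MvPolynomial (Fin 2) k))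
      (MvPolynomial.eval₂Hom MvPolynomial.C (lamVal k) F) :=
  Ideal.Quotient.lift_mk _ _ _

/-- `λ(ȳ) = y`. [folklore] -/
theorem lam_tr_zero : lam k (tr k 0) =
    algebraMap (MvPolynomial (Fin 2) k) (Localization.Away (X 0 : MvPolynomial (Fin 2) k)) (X 0) := by
  change lam k (mkY k (X 1)) = _
  rw [lam_mkY, MvPolynomial.eval₂Hom_X', lamVal_1]

/-- `λ(ȳ)` is a unit. [folklore] -/
theorem isUnit_lam_tr_zero : IsUnit (lam k (tr k 0)) := by
  rw [lam_tr_zero]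
  exact IsLocalization.Away.algebraMap_isUnit (X 0 : MvPolynomial (Fin 2) k)

/-- **`Λ : 𝒪_{𝒴₁}[1/ȳ] → k[y,t][1/y]`**, the left inverse of `ψ₁` after localisation. OURS bookkeeping. -/
def Λ : Localization.Away (tr k 0) →+* Localization.Away (X 0 : MvPolynomial (Fin 2) k) :=
  IsLocalization.Away.lift (tr k 0) (isUnit_lam_tr_zero k)

/-- `Λ` extends `λ`. [folklore] -/
theorem Λ_algebraMap (y : OY k) : Λ k (algebraMap (OY k) (Localization.Away (tr k 0)) y) = lam k y :=
  IsLocalization.Away.lift_eq (tr k 0) (isUnit_lam_tr_zero k) y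

/-- **`Λ ∘ ψ₁ = (k[y,t] → k[y,t][1/y])`.** [folklore] -/
theorem Λ_comp_ψ :
    (Λ k).comp (((B k).val : B k →+* Localization.Away (tr k 0)).comp (ψ k)) =
      algebraMap (MvPolynomial (Fin 2) k) (Localization.Away (X 0 : MvPolynomial (Fin 2) k)) := by
  refine MvPolynomial.ringHom_ext (fun a => ?_) (fun j => ?_)
  · rw [RingHom.comp_apply, RingHom.comp_apply, ψ_C]
    change Λ k (algebraMap (OY k) (Localization.Away (tr k 0)) (mkY k (C a))) = _
    rw [Λ_algebraMap, lam_mkY, MvPolynomial.eval₂Hom_C]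
  · rw [RingHom.comp_apply, RingHom.comp_apply]
    match j with
    | ⟨0, _⟩ =>
      change Λ k ((ψ k (X 0) : B k) : Localization.Away (tr k 0)) = algebraMap _ _ (X 0)
      rw [ψ_X₀]
      change Λ k (algebraMap (OY k) (Localization.Away (tr k 0)) (mkY k (X 1))) = _
      rw [Λ_algebraMap, lam_mkY, MvPolynomial.eval₂Hom_X']
      rfl
    | ⟨1, _⟩ =>
      change Λ k ((ψ k (X 1) : B k) : Localization.Away (tr k 0)) = algebraMap _ _ (X 1)
      rw [ψ_X₁]
      change Λ k (algebraMap (OY k) (Localization.Away (tr k 0)) (mkY k (X 2))) = _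
      rw [Λ_algebraMap, lam_mkY, MvPolynomial.eval₂Hom_X']
      rfl

/-- **`ψ₁` is injective** (`k` a domain). [folklore] -/
theorem ψ_injective [IsDomain k] : Function.Injective (ψ k) := by
  have hinj : Function.Injective
      (algebraMap (MvPolynomial (Fin 2) k) (Localization.Away (X 0 : MvPolynomial (Fin 2) k))) :=
    IsLocalization.injective _ (powers_le_nonZeroDivisors_of_noZeroDivisors (MvPolynomial.X_ne_zero 0))
  rw [← Λ_comp_ψ, RingHom.coe_comp, RingHom.coe_comp] at hinj
  exact hinj.of_comp.of_comp

/-- **A₁ CHART (model form): `ψ₁ : k[y, t] → B₁ = 𝒪_{𝒴₁}[(x̄,ȳ)/ȳ]` is a bijection** — on the chart `ȳ ≠ 0` of the blow-up of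
`{xy = 0}` along `(x̄, ȳ)` only the sheet `{x = 0}` survives, an affine plane: the two sheets are separated. OURS. -/
theorem ψ_bijective [IsDomain k] : Function.Bijective (ψ k) :=
  ⟨ψ_injective k, ψ_surjective k⟩

/-- **The A₁ chart `B₁` is a regular ring** (over a field) — THEOREM A (2.7), transversal points. OURS. -/
theorem isRegularRing_B (K : Type u) [Field K] : IsRegularRing (B K) :=
  IsRegularRing.of_ringEquiv (RingEquiv.ofBijective (ψ K) (ψ_bijective K))

end A1Chart


end Summit.ResolutionOfSingularities.ResolutionOfSingularities.Cruxes.EquisingularLiftNat.Sections
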